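import Summits.QuantumFields.YangMills.Theorems.AllWindowsColdBoxBoxHighLineSmallFieldSmallPlaquettes
import Summits.QuantumFields.YangMills.Theorems.AllWindowsColdBoxBoxHighLineQuadFormSplit
import Summits.QuantumFields.YangMills.Theorems.AllWindowsColdBoxBoxHighLineBoxQuadFormFloor
import Literature.MathematicalPhysics.QuantumFieldTheory.LatticeGaugeDobrushin

/-!
# TASK T-S5.6a `ActionSandwich`, bricks 3 + 5: the WILSON half — `|S(U(a)) − Σ_{p touching} |ℓ_p(a)|²| ≤ (546·tH + 107328·t²H²)·boxQuadForm H a`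

Planner ym-idea-2 g18 (✓`…Step2Defs` T-S5.6a, routed to the w2 seat; this file: width seat `ym-line-sfw-p2-w2` g31, successor of g30).
With ✓brick 2 (`PlaqCost.abs_plaquetteCost_sub_dot_le`, the plaquette cost in the `sinc`-rescaled variables; via ✓`…SmallFieldSmallPlaquettes`,
whose `SmallFieldPlaq.dotProduct_self_eq_norm_sq` / `norm_freeVec_le` are reused), ✓T-S5.7e
(`quadFormSplit` / `QuadSplit.linCurv_eq_plaqLin`: `Σ_{p touching}|ℓ_p|² + Σ_x|(d*a)_x|² = boxQuadForm`, `ℓ_p` = signed edge sum) and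
✓`BoxQuadForm.sum_norm_sq_le_boxQuadForm` (`Σ_e‖a_e‖² ≤ 344H²·boxQuadForm`, from ✓S1):

* `chartPlaqCost_eq` — the chart plaquette cost is `2 − Re tr(U₀U₁U₂⁻¹U₃⁻¹)`, `U_i = expPauli (plaqVar … i)`;
* **brick 3** `abs_chartPlaqCost_sub_norm_sq_le` — pass from `s = Σ±sinc‖v_i‖·v_i` to the true circulation `b = v₀+v₁−v₂−v₃`
  (`|sinc r − 1| ≤ r²/6`): for `‖v_i‖ ≤ t ≤ 1`, `|c_p − ‖b‖²| ≤ 3t‖b‖Σ‖v_i‖ + 13t²Σ‖v_i‖²`;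
* counting: `boxWilson_edgeChart_eq_sum` (`S(U(a)) = Σ_{p touching} c_p`), `sum_plaqVar_norm_sq_le` (`Σ_p Σ_i ‖v_{p,i}‖² ≤ 24 Σ_e ‖a_e‖²`:
  a link lies in `≤ 6` plaquettes, ✓`card_plaquettesTouching_singleton_le`), `sum_norm_plaqLin_sq_le` (`Σ_p ‖b_p‖² ≤ boxQuadForm`);
* **brick 5** `abs_boxWilson_sub_sum_linCurvSq_le` — Cauchy–Schwarz over the plaquettes and the Poincaré floor:
  `|S(U(a)) − Σ_p |ℓ_p|²| ≤ (546·t·H + 107328·t²·H²)·boxQuadForm H a` for `H ≥ 1`, `‖a_e‖ ≤ t ≤ 1`.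

The `landauPhi` half and the assembly of `actionSandwich : ActionSandwich` are the next file.
HONEST LABEL: support bricks of T-S5.6a (an M task of STEP 2 of the XL stub S5 of a critic-PASSed DRAFT line); T-S5.6a itself, S5, U5,
⟨stmt-QuantumFields-24004⟩ ⟨24335⟩ ⟨24336⟩ remain OPEN; no crux, rung or summit is proved; the Yang–Mills mass gap is NOT proved by this file.
-/

set_option autoImplicit false

noncomputable section

open Matrix Finset
open Literature.Probability.LatticeModels (Site)
open Literature.MathematicalPhysics.QuantumFieldTheory (Plaq card_plaquettesTouching_singleton_le mem_plaquettesTouching_singleton)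
open Literature.MathematicalPhysics.QuantumFieldTheory.AxialGauge (boxEdges)
open Literature.MathematicalPhysics.QuantumFieldTheory.LatticeMaxwell (boxEdgesAt)
open Literature.MathematicalPhysics.QuantumFieldTheory.Balaban1983to89.B10Eq18SigmaSU2 (su2Coord)
open Literature.MathematicalPhysics.QuantumFieldTheory.Balaban1983to89.B10Eq18SigmaSU2Haar (expPauli)
open Literature.MathematicalPhysics.QuantumLattice (LGConfig ZdEdge ZdPlaquette fundamentalRep plaquettesTouching plaquetteEdges
  plaquetteHolonomyZd plaquetteObs wilsonBoundaryAction mem_plaquettesTouching_iff fundamentalRep_apply)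
open Summit.QuantumFields.YangMills.Theorems.WeakCouplingRates (plaqCostAt dirCorner)

namespace Summit.QuantumFields.YangMills.Theorems.AllWindowsColdBoxBoxHighLine

namespace WilsonSandwich

/-! ## Vectors of `E3` -/

/-- `√(ofLp x · ofLp x) = ‖x‖` (✓`SmallFieldPlaq.dotProduct_self_eq_norm_sq`). -/
theorem sqrt_dot_self (x : E3) : Real.sqrt (WithLp.ofLp x ⬝ᵥ WithLp.ofLp x) = ‖x‖ := by
  rw [SmallFieldPlaq.dotProduct_self_eq_norm_sq, Real.sqrt_sq (norm_nonneg _)]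

/-- `(Σ_i ‖v_i‖)² ≤ 4·Σ_i ‖v_i‖²` for four vectors (Cauchy–Schwarz, Mathlib's `sq_sum_le_card_mul_sum_sq`). -/
theorem sq_sum_norm_le_four_mul (v : Fin 4 → E3) : (∑ i, ‖v i‖) ^ 2 ≤ 4 * ∑ i, ‖v i‖ ^ 2 := by
  have h := sq_sum_le_card_mul_sum_sq (s := (Finset.univ : Finset (Fin 4))) (f := fun i => ‖v i‖)
  simpa using h

/-! ## Brick 3: from the `sinc`-rescaled sum to the true circulation -/

/-- The `sinc`-rescaled signed sum minus the circulation: `Σ ±(sinc‖v_i‖ − 1)·v_i` has norm `≤ (t²/6)·Σ‖v_i‖` when `‖v_i‖ ≤ t`. -/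
theorem norm_sincSum_sub_plaqLin_le (v : Fin 4 → E3) {t : ℝ} (hv : ∀ i, ‖v i‖ ≤ t) :
    ‖(Real.sinc ‖v 0‖ • v 0 + Real.sinc ‖v 1‖ • v 1 - Real.sinc ‖v 2‖ • v 2 - Real.sinc ‖v 3‖ • v 3) - plaqLin v‖ ≤
      t ^ 2 / 6 * (‖v 0‖ + ‖v 1‖ + ‖v 2‖ + ‖v 3‖) := by
  have hrw : (Real.sinc ‖v 0‖ • v 0 + Real.sinc ‖v 1‖ • v 1 - Real.sinc ‖v 2‖ • v 2 - Real.sinc ‖v 3‖ • v 3) - plaqLin v =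
      (Real.sinc ‖v 0‖ - 1) • v 0 + (Real.sinc ‖v 1‖ - 1) • v 1 - (Real.sinc ‖v 2‖ - 1) • v 2 - (Real.sinc ‖v 3‖ - 1) • v 3 := by
    simp only [plaqLin, sub_smul, one_smul]
    abel
  have hone : ∀ i, ‖(Real.sinc ‖v i‖ - 1) • v i‖ ≤ t ^ 2 / 6 * ‖v i‖ := fun i => by
    rw [norm_smul, Real.norm_eq_abs]
    have h1 : |Real.sinc ‖v i‖ - 1| ≤ ‖v i‖ ^ 2 / 6 := abs_sinc_sub_one_le (norm_nonneg _)
    have h2 : ‖v i‖ ^ 2 ≤ t ^ 2 := pow_le_pow_left₀ (norm_nonneg _) (hv i) 2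
    have h3 : |Real.sinc ‖v i‖ - 1| ≤ t ^ 2 / 6 := h1.trans (by linarith)
    exact mul_le_mul_of_nonneg_right h3 (norm_nonneg _)
  rw [hrw]
  calc ‖(Real.sinc ‖v 0‖ - 1) • v 0 + (Real.sinc ‖v 1‖ - 1) • v 1 - (Real.sinc ‖v 2‖ - 1) • v 2 - (Real.sinc ‖v 3‖ - 1) • v 3‖
      ≤ ‖(Real.sinc ‖v 0‖ - 1) • v 0‖ + ‖(Real.sinc ‖v 1‖ - 1) • v 1‖ + ‖(Real.sinc ‖v 2‖ - 1) • v 2‖ +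
          ‖(Real.sinc ‖v 3‖ - 1) • v 3‖ := by
        refine (norm_sub_le _ _).trans ?_
        refine add_le_add ((norm_sub_le _ _).trans (add_le_add (norm_add_le _ _) le_rfl)) le_rfl
    _ ≤ t ^ 2 / 6 * ‖v 0‖ + t ^ 2 / 6 * ‖v 1‖ + t ^ 2 / 6 * ‖v 2‖ + t ^ 2 / 6 * ‖v 3‖ :=
        add_le_add (add_le_add (add_le_add (hone 0) (hone 1)) (hone 2)) (hone 3)
    _ = t ^ 2 / 6 * (‖v 0‖ + ‖v 1‖ + ‖v 2‖ + ‖v 3‖) := by ring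

/-- Scalar bookkeeping of brick 3: from `|c − S²| ≤ 2tSA + 11t²B`, `|S − b| ≤ (t²/6)A`, `A ≤ 4t`, `A² ≤ 4B`, `t ≤ 1`
(`S, b ≥ 0`) to `|c − b²| ≤ 3tbA + 13t²B`. -/
theorem scalar_pass {c S b A B t : ℝ} (ht0 : 0 ≤ t) (ht : t ≤ 1) (hS : 0 ≤ S) (hb : 0 ≤ b) (hA : 0 ≤ A)
    (hAB : A ^ 2 ≤ 4 * B) (hc : |c - S ^ 2| ≤ 2 * t * S * A + 11 * t ^ 2 * B)
    (hSb : |S - b| ≤ t ^ 2 / 6 * A) : |c - b ^ 2| ≤ 3 * t * b * A + 13 * t ^ 2 * B := by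
  set δ : ℝ := t ^ 2 / 6 * A with hδ
  have hδ0 : 0 ≤ δ := by positivity
  have hB0 : 0 ≤ B := by nlinarith [sq_nonneg A]
  have hSle : S ≤ b + δ := by linarith [(abs_le.1 hSb).2]
  have hsq : |S ^ 2 - b ^ 2| ≤ δ * (2 * b + δ) := by
    have h1 : S ^ 2 - b ^ 2 = (S - b) * (S + b) := by ring
    rw [h1, abs_mul, abs_of_nonneg (by linarith : 0 ≤ S + b)]
    calc |S - b| * (S + b) ≤ δ * (S + b) := mul_le_mul_of_nonneg_right hSb (by linarith)
      _ ≤ δ * (2 * b + δ) := mul_le_mul_of_nonneg_left (by linarith) hδ0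
  have htri : |c - b ^ 2| ≤ |c - S ^ 2| + |S ^ 2 - b ^ 2| := by
    have := abs_add_le (c - S ^ 2) (S ^ 2 - b ^ 2)
    rwa [show c - S ^ 2 + (S ^ 2 - b ^ 2) = c - b ^ 2 by ring] at this
  have hmain : |c - b ^ 2| ≤ 2 * t * (b + δ) * A + 11 * t ^ 2 * B + δ * (2 * b + δ) := by
    have h2 : 2 * t * S * A ≤ 2 * t * (b + δ) * A := by
      have : 0 ≤ 2 * t * A := by positivity
      nlinarith
    linarith
  -- the three correction terms
  have ht2 : t ^ 2 ≤ t := by nlinarith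
  have ht3 : t ^ 3 ≤ t ^ 2 := by nlinarith
  have e1 : 2 * t * δ * A ≤ 4 / 3 * t ^ 2 * B := by
    have : 2 * t * δ * A = t ^ 3 / 3 * A ^ 2 := by rw [hδ]; ring
    rw [this]
    calc t ^ 3 / 3 * A ^ 2 ≤ t ^ 3 / 3 * (4 * B) := mul_le_mul_of_nonneg_left hAB (by positivity)
      _ = 4 / 3 * t ^ 3 * B := by ring
      _ ≤ 4 / 3 * t ^ 2 * B := by nlinarith
  have e2 : δ * (2 * b) ≤ 1 / 3 * t * b * A := by
    have : δ * (2 * b) = 1 / 3 * t ^ 2 * (b * A) := by rw [hδ]; ring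
    rw [this]
    have hbA : 0 ≤ b * A := by positivity
    nlinarith
  have e3 : δ * δ ≤ 1 / 9 * t ^ 2 * B := by
    have : δ * δ = t ^ 4 / 36 * A ^ 2 := by rw [hδ]; ring
    rw [this]
    have ht4 : t ^ 4 ≤ t ^ 2 := by nlinarith
    calc t ^ 4 / 36 * A ^ 2 ≤ t ^ 4 / 36 * (4 * B) := mul_le_mul_of_nonneg_left hAB (by positivity)
      _ = 1 / 9 * t ^ 4 * B := by ring
      _ ≤ 1 / 9 * t ^ 2 * B := by nlinarith
  have hexp : 2 * t * (b + δ) * A + 11 * t ^ 2 * B + δ * (2 * b + δ) =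
      2 * t * b * A + 2 * t * δ * A + 11 * t ^ 2 * B + δ * (2 * b) + δ * δ := by ring
  have htbA : 0 ≤ t * b * A := by positivity
  have ht2B : 0 ≤ t ^ 2 * B := by positivity
  linarith

/-! ## The chart plaquette cost -/

/-- The chart plaquette cost is `2 − Re tr(U₀U₁U₂⁻¹U₃⁻¹)` with `U_i = expPauli (plaqVar H x μ ν a i)`. -/
theorem chartPlaqCost_eq (H : ℕ) (x : Site 4) (μ ν : Fin 4) (a : LandauFree H → E3) :
    chartPlaqCost H x μ ν a =
      2 - (((expPauli (plaqVar H x μ ν a 0) * expPauli (plaqVar H x μ ν a 1) * (expPauli (plaqVar H x μ ν a 2))⁻¹ *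
        (expPauli (plaqVar H x μ ν a 3))⁻¹ : SU2) : Matrix (Fin 2) (Fin 2) ℂ)).trace.re := by
  simp only [chartPlaqCost, plaqCostAt, plaquetteObs, fundamentalRep_apply, plaquetteHolonomyZd, Nat.cast_ofNat]
  rfl

/-- **Brick 3 (four chart points).**  For `‖v_i‖ ≤ t ≤ 1` and `b = plaqLin v = v₀+v₁−v₂−v₃`:
`|2 − Re tr(U₀U₁U₂⁻¹U₃⁻¹) − ‖b‖²| ≤ 3t·‖b‖·Σ‖v_i‖ + 13t²·Σ‖v_i‖²`, `U_i = expPauli v_i`. -/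
theorem abs_cost_sub_norm_plaqLin_sq_le (v : Fin 4 → E3) {t : ℝ} (ht0 : 0 ≤ t) (ht : t ≤ 1) (hv : ∀ i, ‖v i‖ ≤ t) :
    |2 - (((expPauli (v 0) * expPauli (v 1) * (expPauli (v 2))⁻¹ * (expPauli (v 3))⁻¹ : SU2) :
        Matrix (Fin 2) (Fin 2) ℂ)).trace.re - ‖plaqLin v‖ ^ 2| ≤
      3 * t * ‖plaqLin v‖ * ∑ i, ‖v i‖ + 13 * t ^ 2 * ∑ i, ‖v i‖ ^ 2 := by
  have hS : Real.sinc ‖v 0‖ • WithLp.ofLp (v 0) + Real.sinc ‖v 1‖ • WithLp.ofLp (v 1) - Real.sinc ‖v 2‖ • WithLp.ofLp (v 2) -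
      Real.sinc ‖v 3‖ • WithLp.ofLp (v 3) =
      WithLp.ofLp (Real.sinc ‖v 0‖ • v 0 + Real.sinc ‖v 1‖ • v 1 - Real.sinc ‖v 2‖ • v 2 - Real.sinc ‖v 3‖ • v 3) := by
    simp only [WithLp.ofLp_add, WithLp.ofLp_sub, WithLp.ofLp_smul]
  have h2 := PlaqCost.abs_plaquetteCost_sub_dot_le (v 0) (v 1) (v 2) (v 3) ht (hv 0) (hv 1) (hv 2) (hv 3)
  rw [hS, sqrt_dot_self, SmallFieldPlaq.dotProduct_self_eq_norm_sq, ← Fin.sum_univ_four (fun i => ‖v i‖),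
    ← Fin.sum_univ_four (fun i => ‖v i‖ ^ 2)] at h2
  have hSb : |‖Real.sinc ‖v 0‖ • v 0 + Real.sinc ‖v 1‖ • v 1 - Real.sinc ‖v 2‖ • v 2 - Real.sinc ‖v 3‖ • v 3‖ - ‖plaqLin v‖| ≤
      t ^ 2 / 6 * ∑ i, ‖v i‖ := by
    rw [Fin.sum_univ_four]
    exact (abs_norm_sub_norm_le _ (plaqLin v)).trans (norm_sincSum_sub_plaqLin_le v hv)
  exact scalar_pass ht0 ht (norm_nonneg _) (norm_nonneg _) (Finset.sum_nonneg fun i _ => norm_nonneg _)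
    (sq_sum_norm_le_four_mul v) h2 hSb

/-- **Brick 3 (per plaquette, chart form).**  For `‖plaqVar … i‖ ≤ t ≤ 1`:
`|c_p − ‖plaqLin (plaqVar …)‖²| ≤ 3t·‖plaqLin‖·Σ‖v_i‖ + 13t²·Σ‖v_i‖²`. -/
theorem abs_chartPlaqCost_sub_norm_sq_le (H : ℕ) (x : Site 4) (μ ν : Fin 4) (a : LandauFree H → E3) {t : ℝ}
    (ht0 : 0 ≤ t) (ht : t ≤ 1) (hv : ∀ i, ‖plaqVar H x μ ν a i‖ ≤ t) :
    |chartPlaqCost H x μ ν a - ‖plaqLin (plaqVar H x μ ν a)‖ ^ 2| ≤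
      3 * t * ‖plaqLin (plaqVar H x μ ν a)‖ * ∑ i, ‖plaqVar H x μ ν a i‖ +
        13 * t ^ 2 * ∑ i, ‖plaqVar H x μ ν a i‖ ^ 2 := by
  rw [chartPlaqCost_eq]
  exact abs_cost_sub_norm_plaqLin_sq_le (plaqVar H x μ ν a) ht0 ht hv

/-! ## The Wilson action of the chart as a plaquette sum; edge counting -/

/-- `S(U(a)) = Σ_{p touching the box} c_p(a)`. -/
theorem boxWilson_edgeChart_eq_sum (H : ℕ) (a : LandauFree H → E3) :
    boxWilson H (edgeChart H a) = ∑ p ∈ plaquettesTouching (boxEdges 4 (2 * H + 1)), chartPlaqCost H p.1 p.2.1.1 p.2.1.2 a := by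
  simp only [boxWilson, wilsonBoundaryAction, chartPlaqCost, plaqCostAt]

/-- `‖freeVec H a e'‖² = Σ_e [e = e']·‖a_e‖²` (at most one term). -/
theorem norm_freeVec_sq_eq_sum {H : ℕ} (a : LandauFree H → E3) (e' : ZdEdge 4) :
    ‖freeVec H a e'‖ ^ 2 = ∑ e : LandauFree H, if e.1.1 = e' then ‖a e‖ ^ 2 else 0 := by
  classical
  by_cases h : e' ∈ boxEdgesAt dirCorner (2 * H + 3)
  · by_cases h' : e' ∈ boxEdges 4 (2 * H + 1)
    · have hfv : freeVec H a e' = a ⟨⟨e', h⟩, not_not_intro h'⟩ := by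
        rw [freeVec, dif_pos h, dif_pos h']
      rw [hfv, Finset.sum_eq_single (⟨⟨e', h⟩, not_not_intro h'⟩ : LandauFree H)]
      · simp
      · intro e _ hne
        rw [if_neg]
        intro hee
        exact hne (Subtype.ext (Subtype.ext hee))
      · simp
    · have hfv : freeVec H a e' = 0 := by rw [freeVec, dif_pos h, dif_neg h']
      rw [hfv, norm_zero, zero_pow two_ne_zero]
      symm
      refine Finset.sum_eq_zero fun e _ => ?_
      rw [if_neg]
      intro hee
      exact e.2 (hee ▸ h' : e.1.1 ∉ boxEdges 4 (2 * H + 1))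
  · have hfv : freeVec H a e' = 0 := by rw [freeVec, dif_neg h]
    rw [hfv, norm_zero, zero_pow two_ne_zero]
    symm
    refine Finset.sum_eq_zero fun e _ => ?_
    rw [if_neg]
    intro hee
    exact h (hee ▸ e.1.2)

/-- The `i`-th edge of `plaqEdge` is one of the four `plaquetteEdges`. -/
theorem plaqEdge_mem_plaquetteEdges (p : ZdPlaquette 4) (i : Fin 4) :
    plaqEdge p.1 p.2.1.1 p.2.1.2 i ∈ plaquetteEdges p := by
  fin_cases i <;> simp [plaqEdge, plaquetteEdges]

/-- **A link lies on at most `24` (plaquette, position) pairs** among the plaquettes touching the box. -/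
theorem sum_indicator_plaqEdge_le (H : ℕ) (e' : ZdEdge 4) :
    ∑ p ∈ plaquettesTouching (boxEdges 4 (2 * H + 1)), ∑ i : Fin 4,
      (if plaqEdge p.1 p.2.1.1 p.2.1.2 i = e' then (1 : ℝ) else 0) ≤ 24 := by
  classical
  set P := plaquettesTouching (boxEdges 4 (2 * H + 1)) with hP
  have hstep : ∀ p ∈ P, ∑ i : Fin 4, (if plaqEdge p.1 p.2.1.1 p.2.1.2 i = e' then (1 : ℝ) else 0) ≤
      if e' ∈ plaquetteEdges p then 4 else 0 := by
    intro p _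
    by_cases he : e' ∈ plaquetteEdges p
    · rw [if_pos he]
      calc ∑ i : Fin 4, (if plaqEdge p.1 p.2.1.1 p.2.1.2 i = e' then (1 : ℝ) else 0) ≤ ∑ _i : Fin 4, (1 : ℝ) :=
            Finset.sum_le_sum fun i _ => by split_ifs <;> norm_num
        _ = 4 := by simp
    · rw [if_neg he]
      refine (Finset.sum_eq_zero fun i _ => ?_).le
      rw [if_neg]
      intro hi
      exact he (hi ▸ plaqEdge_mem_plaquetteEdges p i)
  refine (Finset.sum_le_sum hstep).trans ?_
  rw [← Finset.sum_filter, Finset.sum_const, nsmul_eq_mul]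
  have hsub : P.filter (fun p => e' ∈ plaquetteEdges p) ⊆ plaquettesTouching {e'} := by
    intro p hp
    rw [Finset.mem_filter] at hp
    exact mem_plaquettesTouching_singleton.2 hp.2
  have hcard : (#(P.filter (fun p => e' ∈ plaquetteEdges p)) : ℝ) ≤ 6 := by
    have h1 := (Finset.card_le_card hsub).trans (card_plaquettesTouching_singleton_le e')
    have h6 : #(P.filter (fun p => e' ∈ plaquetteEdges p)) ≤ 6 := h1.trans (by norm_num)
    exact_mod_cast h6
  linarith

/-- **`Σ_{p touching} Σ_i ‖v_{p,i}‖² ≤ 24·Σ_e ‖a_e‖²`.** -/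
theorem sum_plaqVar_norm_sq_le (H : ℕ) (a : LandauFree H → E3) :
    ∑ p ∈ plaquettesTouching (boxEdges 4 (2 * H + 1)), ∑ i : Fin 4, ‖plaqVar H p.1 p.2.1.1 p.2.1.2 a i‖ ^ 2 ≤
      24 * ∑ e : LandauFree H, ‖a e‖ ^ 2 := by
  classical
  set P := plaquettesTouching (boxEdges 4 (2 * H + 1)) with hP
  have hexp : ∀ p ∈ P, ∑ i : Fin 4, ‖plaqVar H p.1 p.2.1.1 p.2.1.2 a i‖ ^ 2 =
      ∑ e : LandauFree H, ‖a e‖ ^ 2 * ∑ i : Fin 4, (if plaqEdge p.1 p.2.1.1 p.2.1.2 i = e.1.1 then (1 : ℝ) else 0) := by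
    intro p _
    simp only [plaqVar, norm_freeVec_sq_eq_sum, Finset.mul_sum]
    rw [Finset.sum_comm]
    refine Finset.sum_congr rfl fun e _ => Finset.sum_congr rfl fun i _ => ?_
    by_cases h : e.1.1 = plaqEdge p.1 p.2.1.1 p.2.1.2 i
    · rw [if_pos h, if_pos h.symm, mul_one]
    · rw [if_neg h, if_neg (Ne.symm h), mul_zero]
  rw [Finset.sum_congr rfl hexp, Finset.sum_comm, Finset.mul_sum]
  refine Finset.sum_le_sum fun e _ => ?_
  rw [← Finset.mul_sum, mul_comm]
  exact mul_le_mul_of_nonneg_right (sum_indicator_plaqEdge_le H e.1.1) (sq_nonneg _)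

/-- `|ℓ_p(a)|² = ‖plaqLin (plaqVar …)‖²` (✓`QuadSplit.linCurv_eq_plaqLin`). -/
theorem linCurvSq_eq_norm_sq (H : ℕ) (a : LandauFree H → E3) (x : Site 4) (μ ν : Fin 4) :
    linCurvSq H (x, μ, ν) a = ‖plaqLin (plaqVar H x μ ν a)‖ ^ 2 := by
  rw [linCurvSq, BoxQuadForm.norm_sq_eq_sum]
  exact Finset.sum_congr rfl fun c _ => by rw [QuadSplit.linCurv_eq_plaqLin]

/-- `Σ_{p touching} ‖b_p‖² ≤ boxQuadForm H a` (✓`quadFormSplit`; the divergence part is non-negative). -/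
theorem sum_norm_plaqLin_sq_le {H : ℕ} (hH : 1 ≤ H) (a : LandauFree H → E3) :
    ∑ p ∈ plaquettesTouching (boxEdges 4 (2 * H + 1)), ‖plaqLin (plaqVar H p.1 p.2.1.1 p.2.1.2 a)‖ ^ 2 ≤ boxQuadForm H a := by
  have h := (quadFormSplit H hH a).1
  have hdiv : 0 ≤ divLinSq H a := Finset.sum_nonneg fun _ _ => Finset.sum_nonneg fun _ _ => sq_nonneg _
  have heq : ∑ p ∈ plaquettesTouching (boxEdges 4 (2 * H + 1)), ‖plaqLin (plaqVar H p.1 p.2.1.1 p.2.1.2 a)‖ ^ 2 =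
      ∑ p ∈ plaquettesTouching (boxEdges 4 (2 * H + 1)), linCurvSq H (p.1, p.2.1.1, p.2.1.2) a :=
    Finset.sum_congr rfl fun p _ => (linCurvSq_eq_norm_sq H a _ _ _).symm
  linarith

/-! ## Brick 5: the Wilson half of the sandwich -/

/-- **The Wilson half of T-S5.6a.**  For `H ≥ 1` and `‖a_e‖ ≤ t ≤ 1`:
`|S(U(a)) − Σ_{p touching} |ℓ_p(a)|²| ≤ (546·t·H + 107328·t²·H²)·boxQuadForm H a`. -/
theorem abs_boxWilson_sub_sum_linCurvSq_le {H : ℕ} (hH : 1 ≤ H) {t : ℝ} (ht0 : 0 ≤ t) (ht : t ≤ 1)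
    (a : LandauFree H → E3) (ha : ∀ e, ‖a e‖ ≤ t) :
    |boxWilson H (edgeChart H a) - ∑ p ∈ plaquettesTouching (boxEdges 4 (2 * H + 1)), linCurvSq H (p.1, p.2.1.1, p.2.1.2) a| ≤
      (546 * t * H + 107328 * t ^ 2 * (H : ℝ) ^ 2) * boxQuadForm H a := by
  classical
  set P := plaquettesTouching (boxEdges 4 (2 * H + 1)) with hP
  set Q := boxQuadForm H a with hQ
  -- notation: b_p, A_p, B_p
  set nb : ZdPlaquette 4 → ℝ := fun p => ‖plaqLin (plaqVar H p.1 p.2.1.1 p.2.1.2 a)‖ with hnb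
  set A : ZdPlaquette 4 → ℝ := fun p => ∑ i : Fin 4, ‖plaqVar H p.1 p.2.1.1 p.2.1.2 a i‖ with hA
  set B : ZdPlaquette 4 → ℝ := fun p => ∑ i : Fin 4, ‖plaqVar H p.1 p.2.1.1 p.2.1.2 a i‖ ^ 2 with hB
  have hQ0 : 0 ≤ Q := BoxQuadForm.boxQuadForm_nonneg hH a
  have hH1 : (1 : ℝ) ≤ H := by exact_mod_cast hH
  have hsumsq : ∑ e : LandauFree H, ‖a e‖ ^ 2 ≤ 344 * (H : ℝ) ^ 2 * Q := BoxQuadForm.sum_norm_sq_le_boxQuadForm hH a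
  -- Σ B ≤ 24·344 H² Q
  have hBsum : ∑ p ∈ P, B p ≤ 24 * (344 * (H : ℝ) ^ 2 * Q) :=
    (sum_plaqVar_norm_sq_le H a).trans (mul_le_mul_of_nonneg_left hsumsq (by norm_num))
  -- Σ A² ≤ 4 Σ B
  have hA2 : ∑ p ∈ P, A p ^ 2 ≤ 4 * ∑ p ∈ P, B p := by
    rw [Finset.mul_sum]
    refine Finset.sum_le_sum fun p _ => ?_
    exact sq_sum_norm_le_four_mul _
  -- Σ nb² ≤ Q
  have hnb2 : ∑ p ∈ P, nb p ^ 2 ≤ Q := sum_norm_plaqLin_sq_le hH a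
  -- Cauchy–Schwarz: Σ nb·A ≤ 182·H·Q
  have hCS : ∑ p ∈ P, nb p * A p ≤ 182 * H * Q := by
    have h1 : (∑ p ∈ P, nb p * A p) ^ 2 ≤ (∑ p ∈ P, nb p ^ 2) * ∑ p ∈ P, A p ^ 2 :=
      Finset.sum_mul_sq_le_sq_mul_sq P nb A
    have h2 : (∑ p ∈ P, nb p ^ 2) * ∑ p ∈ P, A p ^ 2 ≤ Q * (4 * (24 * (344 * (H : ℝ) ^ 2 * Q))) :=
      mul_le_mul hnb2 (hA2.trans (by linarith)) (Finset.sum_nonneg fun _ _ => sq_nonneg _) hQ0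
    have h3 : (∑ p ∈ P, nb p * A p) ^ 2 ≤ (182 * H * Q) ^ 2 := by nlinarith
    have h0 : 0 ≤ ∑ p ∈ P, nb p * A p :=
      Finset.sum_nonneg fun p _ => mul_nonneg (norm_nonneg _) (Finset.sum_nonneg fun _ _ => norm_nonneg _)
    exact (pow_le_pow_iff_left₀ h0 (by positivity) two_ne_zero).1 h3
  -- per plaquette
  have hper : ∀ p ∈ P, |chartPlaqCost H p.1 p.2.1.1 p.2.1.2 a - linCurvSq H (p.1, p.2.1.1, p.2.1.2) a| ≤
      3 * t * (nb p * A p) + 13 * t ^ 2 * B p := by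
    intro p _
    rw [linCurvSq_eq_norm_sq]
    have h := abs_chartPlaqCost_sub_norm_sq_le H p.1 p.2.1.1 p.2.1.2 a ht0 ht
      (fun i => SmallFieldPlaq.norm_freeVec_le (show a ∈ smallField H t from ha) ht0 _)
    simpa only [hnb, hA, hB, mul_assoc] using h
  rw [boxWilson_edgeChart_eq_sum, ← Finset.sum_sub_distrib]
  calc |∑ p ∈ P, (chartPlaqCost H p.1 p.2.1.1 p.2.1.2 a - linCurvSq H (p.1, p.2.1.1, p.2.1.2) a)|
      ≤ ∑ p ∈ P, |chartPlaqCost H p.1 p.2.1.1 p.2.1.2 a - linCurvSq H (p.1, p.2.1.1, p.2.1.2) a| :=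
        Finset.abs_sum_le_sum_abs _ _
    _ ≤ ∑ p ∈ P, (3 * t * (nb p * A p) + 13 * t ^ 2 * B p) := Finset.sum_le_sum hper
    _ = 3 * t * ∑ p ∈ P, nb p * A p + 13 * t ^ 2 * ∑ p ∈ P, B p := by
        rw [Finset.sum_add_distrib, Finset.mul_sum, Finset.mul_sum]
    _ ≤ 3 * t * (182 * H * Q) + 13 * t ^ 2 * (24 * (344 * (H : ℝ) ^ 2 * Q)) :=
        add_le_add (mul_le_mul_of_nonneg_left hCS (by positivity)) (mul_le_mul_of_nonneg_left hBsum (by positivity))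
    _ = (546 * t * H + 107328 * t ^ 2 * (H : ℝ) ^ 2) * Q := by ring

end WilsonSandwich

end Summit.QuantumFields.YangMills.Theorems.AllWindowsColdBoxBoxHighLine

end
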